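import Literature.Probability.LatticeModels.UrsellInversion
import Mathlib.Analysis.Calculus.Deriv.Mul
import Mathlib.Analysis.Calculus.Deriv.Add
import HarnessLib

/-!
# The Ursell function along a differentiable family of moments: differentiating adds an argument

Topic `Literature/Probability/LatticeModels`; a companion of `UrsellInversion.lean` (Möbius inversion
`ursellOf m` of a "moment" function `m` on finite sets, Ruelle 1969 §4.4.1 (4.5)–(4.7)).

The situation formalized here is the one met whenever truncated (connected) expectations are
differentiated along a one-parameter family of measures `dμ_u ∝ e^{−uV}dμ` ("tilting"; the
`s`-derivatives of the interpolated Gaussian expectations of Bałaban–Imbrie–Jaffe 1988 §5.13, the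
`λ`-derivatives `𝓔ᵀ(X; n) = ∂ⁿ_λ log ∫ e^{λX}` of Mastropietro 2008 (2.34)–(2.36)): the moments
`m_u(P)`, `P` a finite set of labels, are differentiable in `u`, the tilt is represented by a
distinguished label `j`, and

  `d/du m_u(P) = m_u(P ∪ {j}) − m_u(P)·m_u({j})`     (`j ∉ P`, `m_u(∅) = 1`),

which is what `d/du ⟨X_P⟩_u = −(⟨V X_P⟩_u − ⟨V⟩_u⟨X_P⟩_u)` says when `X_{P∪j} := −V·X_P`.  THEN THE
URSELL FUNCTIONS OBEY THE SAME RULE WITHOUT THE PRODUCT TERM: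

  `d/du mᵀ_u(W) = mᵀ_u(W ∪ {j})`     (`j ∉ W`, `W ≠ ∅`)

— differentiating a truncated expectation along the tilt inserts the tilting variable as one more
truncated argument.  The proof is strong induction on `W` through the block form of the cluster
decomposition at a vertex `v ∈ W` (`sum_ursellOf_mul_eq`): the blocks of `W ∪ {j}` containing `v` are
the blocks `P₀ ∋ v` of `W` with or without `j` (`sum_filter_powerset_insert`).

## Main results

* `sum_filter_powerset_insert` — `Σ_{v∈P⊆W∪j} g P = Σ_{v∈P₀⊆W} g(P₀∪j) + Σ_{v∈P₀⊆W} g P₀` (`j ∉ W ∋ v`);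
* **`hasDerivAt_ursellOf`** — the rule above, for moment functions with values in a nontrivially
  normed field.

Everything is proved; no definition, no named fact.  Filed from the lit-balaban cell (seat p13 gen 12) for
Bałaban–Imbrie–Jaffe 1988 §5.13:
statement-level skeleton of published theorems with citation tags; proofs where landed; nothing here is a claim
about the Yang–Mills mass gap

## Sources

D. Ruelle, *Statistical Mechanics: Rigorous Results* (1969), §4.4.1 (4.5)–(4.7) (`Ruelle1969`);
V. Mastropietro, *Non-Perturbative Renormalization* (2008), §2.3 (2.34)–(2.36) (`Mastropietro2008`);
T. Bałaban, J. Imbrie, A. Jaffe, Commun. Math. Phys. 114 (1988) §5.13 p. 305 (`BalabanImbrieJaffe1988`),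
where the rule is used (implicitly) to all orders.
-/

open Finset

namespace Literature.Probability.LatticeModels

variable {β : Type*} [DecidableEq β]

/-- The blocks `P ∋ v` of `W ∪ {j}` (`j ∉ W`, `v ≠ j`) are the blocks `P₀ ∋ v` of `W`, with or without `j`:
`Σ_{v ∈ P ⊆ W∪j} g P = Σ_{v ∈ P₀ ⊆ W} g (P₀ ∪ j) + Σ_{v ∈ P₀ ⊆ W} g P₀` (finite-set bookkeeping for the block form of
the cluster decomposition, Ruelle 1969 (4.7)). [cite: Ruelle1969, §4.4.1 (4.7)] -/
theorem sum_filter_powerset_insert {M : Type*} [AddCommMonoid M] {W : Finset β} {j v : β} (hj : j ∉ W)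
    (hvj : v ≠ j) (g : Finset β → M) :
    ∑ P ∈ (insert j W).powerset.filter (fun P => v ∈ P), g P
      = ∑ P ∈ W.powerset.filter (fun P => v ∈ P), g (insert j P)
        + ∑ P ∈ W.powerset.filter (fun P => v ∈ P), g P := by
  have hdisj : Disjoint (W.powerset.filter fun P => v ∈ P)
      ((W.powerset.image (insert j)).filter fun P => v ∈ P) := by
    rw [disjoint_left]
    intro P hP hP2
    obtain ⟨Q, -, hQP⟩ := mem_image.1 (mem_filter.1 hP2).1
    have hjP : j ∈ P := hQP ▸ mem_insert_self j Q
    exact hj (mem_powerset.1 (mem_filter.1 hP).1 hjP)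
  rw [powerset_insert, filter_union, sum_union hdisj, add_comm]
  congr 1
  rw [filter_image, sum_image]
  · exact sum_congr (filter_congr fun P _ => by simp [hvj]) fun _ _ => rfl
  · intro P hP Q hQ h
    have hP' : j ∉ P := fun hjP => hj (mem_powerset.1 (mem_filter.1 hP).1 hjP)
    have hQ' : j ∉ Q := fun hjQ => hj (mem_powerset.1 (mem_filter.1 hQ).1 hjQ)
    rw [← erase_insert hP', h, erase_insert hQ']

variable {𝕜 : Type*} [NontriviallyNormedField 𝕜]

/-- **Differentiating a truncated function along a tilt adds an argument.**  If the moments `u ↦ m_u(P)`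
satisfy `m_u(∅) = 1` and `d/du m_u(P)|_{u₀} = m_{u₀}(P ∪ j) − m_{u₀}(P)m_{u₀}{j}` for every `P ∌ j`, then for
every nonempty `W ∌ j`

  `d/du mᵀ_u(W)|_{u₀} = mᵀ_{u₀}(W ∪ j)`.

This is the finite (Möbius-inversion) form of the generating-function definition of the truncated
expectations, Mastropietro 2008 (2.32) `𝓔ᵀ(X₁,…,X_p) = ∂^p/∂λ₁⋯∂λ_p log ∫P(dψ)e^{λ₁X₁+⋯+λ_pX_p}|_{λ=0}`, read at
`λ ≠ 0`: one more `λ`-derivative of a truncated expectation of the tilted measure is the truncated expectation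
with one more argument.  (Proof: strong induction on `W` through the block form
`m(W) = Σ_{v∈P₀⊆W} mᵀ(P₀)m(W∖P₀)` of the cluster decomposition, Ruelle 1969 (4.7); the blocks of `W ∪ j` at
`v` are those of `W` with or without `j`.) [cite: Mastropietro2008, §2.3 (2.32)] -/
theorem hasDerivAt_ursellOf (m : Finset β → 𝕜 → 𝕜) (j : β) (u₀ : 𝕜) (hm0 : ∀ u, m ∅ u = 1)
    (hm : ∀ P : Finset β, j ∉ P → HasDerivAt (m P) (m (insert j P) u₀ - m P u₀ * m {j} u₀) u₀)
    {W : Finset β} (hjW : j ∉ W) (hW : W.Nonempty) :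
    HasDerivAt (fun u => ursellOf (fun P => m P u) W) (ursellOf (fun P => m P u₀) (insert j W)) u₀ := by
  induction W using Finset.strongInduction with
  | H W ih =>
    obtain ⟨v, hv⟩ := hW
    have hvj : v ≠ j := fun h => hjW (h ▸ hv)
    set F : Finset (Finset β) := W.powerset.filter (fun P => v ∈ P) with hF
    have hWF : W ∈ F := mem_filter.2 ⟨mem_powerset.2 Subset.rfl, hv⟩
    have hF' : ∀ P ∈ F.erase W, P ⊂ W ∧ v ∈ P ∧ j ∉ P := fun P hP => by
      obtain ⟨hne, hP⟩ := mem_erase.1 hP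
      obtain ⟨hPW, hvP⟩ := mem_filter.1 hP
      have hPW' := mem_powerset.1 hPW
      exact ⟨Finset.ssubset_iff_subset_ne.2 ⟨hPW', hne⟩, hvP, fun hjP => hjW (hPW' hjP)⟩
    -- the block form at `v`, at every `u`: `mᵀ(W) + Σ_{v∈P₀⊊W} mᵀ(P₀) m(W∖P₀) = m(W)`
    have hblock : ∀ u, ursellOf (fun P => m P u) W
        + ∑ P ∈ F.erase W, ursellOf (fun Q => m Q u) P * m (W \ P) u = m W u := fun u => by
      have h := sum_ursellOf_mul_eq (fun P => m P u) (hm0 u) hv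
      rwa [← add_sum_erase _ _ hWF, Finset.sdiff_self, hm0, mul_one] at h
    -- the block form at `v` for `W ∪ j`
    have hblockJ : ursellOf (fun P => m P u₀) (insert j W) + ursellOf (fun P => m P u₀) W * m {j} u₀
        + (∑ P ∈ F.erase W, ursellOf (fun Q => m Q u₀) (insert j P) * m (W \ P) u₀
          + ∑ P ∈ F.erase W, ursellOf (fun Q => m Q u₀) P * m (insert j (W \ P)) u₀)
        = m (insert j W) u₀ := by
      have h := sum_ursellOf_mul_eq (fun P => m P u₀) (hm0 u₀) (mem_insert_of_mem hv : v ∈ insert j W)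
      rw [sum_filter_powerset_insert hjW hvj, ← sum_add_distrib, ← add_sum_erase _ _ hWF,
        insert_sdiff_insert, sdiff_insert_of_notMem hjW, Finset.sdiff_self, hm0, mul_one,
        insert_sdiff_of_notMem W hjW, Finset.sdiff_self] at h
      have hs : ∑ P ∈ F.erase W, (ursellOf (fun Q => m Q u₀) (insert j P) * m (insert j W \ insert j P) u₀
            + ursellOf (fun Q => m Q u₀) P * m (insert j W \ P) u₀)
          = ∑ P ∈ F.erase W, ursellOf (fun Q => m Q u₀) (insert j P) * m (W \ P) u₀
            + ∑ P ∈ F.erase W, ursellOf (fun Q => m Q u₀) P * m (insert j (W \ P)) u₀ := by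
        rw [← sum_add_distrib]
        refine sum_congr rfl fun P hP => ?_
        obtain ⟨-, -, hjP⟩ := hF' P hP
        rw [insert_sdiff_insert, sdiff_insert_of_notMem hjW, insert_sdiff_of_notMem W hjP]
      rw [hs] at h
      simpa [add_assoc] using h
    -- the recursion as an identity of functions of `u`, and its derivative
    have hfun : (fun u => ursellOf (fun P => m P u) W)
        = fun u => m W u - ∑ P ∈ F.erase W, ursellOf (fun Q => m Q u) P * m (W \ P) u := by
      funext u
      rw [← hblock u, add_sub_cancel_right]
    have hderiv : HasDerivAt (fun u => m W u - ∑ P ∈ F.erase W, ursellOf (fun Q => m Q u) P * m (W \ P) u)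
        (m (insert j W) u₀ - m W u₀ * m {j} u₀
          - ∑ P ∈ F.erase W, (ursellOf (fun Q => m Q u₀) (insert j P) * m (W \ P) u₀
            + ursellOf (fun Q => m Q u₀) P * (m (insert j (W \ P)) u₀ - m (W \ P) u₀ * m {j} u₀))) u₀ := by
      refine (hm W hjW).sub (HasDerivAt.fun_sum fun P hP => ?_)
      obtain ⟨hPW, hvP, hjP⟩ := hF' P hP
      exact (ih P hPW hjP ⟨v, hvP⟩).mul (hm (W \ P) fun h => hjW (mem_sdiff.1 h).1)
    rw [hfun]
    refine hderiv.congr_deriv ?_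
    have hsplit : ∑ P ∈ F.erase W, (ursellOf (fun Q => m Q u₀) (insert j P) * m (W \ P) u₀
          + ursellOf (fun Q => m Q u₀) P * (m (insert j (W \ P)) u₀ - m (W \ P) u₀ * m {j} u₀))
        = ∑ P ∈ F.erase W, ursellOf (fun Q => m Q u₀) (insert j P) * m (W \ P) u₀
          + ∑ P ∈ F.erase W, ursellOf (fun Q => m Q u₀) P * m (insert j (W \ P)) u₀
          - m {j} u₀ * ∑ P ∈ F.erase W, ursellOf (fun Q => m Q u₀) P * m (W \ P) u₀ := by
      rw [mul_sum, ← sum_add_distrib, ← sum_sub_distrib]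
      exact sum_congr rfl fun P _ => by ring
    rw [hsplit]
    linear_combination m {j} u₀ * hblock u₀ - hblockJ

end Literature.Probability.LatticeModels
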